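import Summits.CriticalPhenomena.SAWScalingLimit.Theorems.SAWRenewalTightnessSubseqIdentificationWindowReduction
import HarnessLib

/-!
# Route-level split glue for the crux `SubseqIdentification` (stmt-CriticalPhenomena-0783),
# line `boundary-area-law`: `C1 → C2 → C3 → SubseqIdentification`

The registered stub `SubseqIdentification_of_subs` (strategist s1's split glue), verbatim. Its three
hypotheses are

* `C1` — the conformal dock: identification of subsequential limits up to `κ` (one `κ > 0` per mesh
  sequence `s → 0⁺`, the same for every Dobrushin domain with an endpoint approximation);
* `C2` — the two-sided lattice `r²` area law at every flat window `D ∩ B(x₀, ρ₀) = {Im z > Im x₀} ∩ B(x₀, ρ₀)`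
  (`x₀ ∉ {a, b}`) of every Dobrushin domain with an endpoint approximation;
* `C3` — ONE Dobrushin domain `D₀` with an endpoint approximation, a flat window at some `x₀ ∉ {a₀, b₀}`,
  and tightness along the mesh of its pushed critical SAW laws.

Proof: `C3` supplies the window `(D₀; a₀, b₀; x₀, ρ₀)` with tightness; `C2` evaluated there supplies the
lattice area law at `x₀`; together they form the window package `W` of the landed one-window reduction
`BoundaryAreaLaw.SubseqIdentification_of_dock_of_window` (p130802, `C1 ∧ W → SubseqIdentification`).
Nothing else is in this file; axioms `propext`, `Classical.choice`, `Quot.sound`.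
-/

open MeasureTheory Filter Topology Set
open scoped NNReal ENNReal BoundedContinuousFunction

namespace Summit.CriticalPhenomena.SAWScalingLimit.Theorems.SubseqIdentification.Split

open Literature.Probability.RandomPlanarGeometry Literature.Probability.LatticeModels
open Summit.CriticalPhenomena.SAWScalingLimit.Theses.SAWParafermion (SubseqIdentification)

/-- **Split glue `C1 → C2 → C3 → SubseqIdentification` (registered stub of stmt-CriticalPhenomena-0783,
line `boundary-area-law`).** The dock `C1` (identification of subsequential limits up to one `κ > 0` per
mesh sequence), the two-sided lattice `r²` area law `C2` at every flat window of every Dobrushin domain,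
and the existence `C3` of ONE Dobrushin domain with an endpoint approximation, a flat window at a
non-marked point and tightness along the mesh, imply the crux. Proof: unpack `C3`, evaluate `C2` at that
window, and apply the landed one-window reduction
`BoundaryAreaLaw.SubseqIdentification_of_dock_of_window` (p130802). [folklore] -/
theorem SubseqIdentification_of_subs :
    (∀ (s : ℕ → ℝ), Tendsto s atTop (𝓝[>] (0 : ℝ)) → ∃ κ : ℝ≥0, 0 < κ ∧ ∀ (D : DobrushinDomain) (a b : ℝ → Site 2), SAW.IsEndpointApprox D a b → ∀ (μ : Measure (CurveClass ℂ)), IsProbabilityMeasure μ → (∀ f : CurveClass ℂ →ᵇ ℝ, Tendsto (fun n => ∫ γ, f γ.curve ∂(SAW.law D.carrier (s n) (a (s n)) (b (s n)))) atTop (𝓝 (∫ x, f x ∂μ))) → IsSLELaw κ D μ) → (∀ (D : DobrushinDomain) (a b : ℝ → Site 2), SAW.IsEndpointApprox D a b → ∀ (x₀ : ℂ) (ρ₀ : ℝ), 0 < ρ₀ → D.carrier ∩ Metric.ball x₀ ρ₀ = {z : ℂ | x₀.im < z.im} ∩ Metric.ball x₀ ρ₀ → x₀ ≠ D.pt 0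 → x₀ ≠ D.pt 1 → ∃ C ε₀ : ℝ, 0 < C ∧ 0 < ε₀ ∧ ∀ r : ℝ, 0 < r → r ≤ ε₀ → ∀ᶠ δ in 𝓝[>] (0 : ℝ), SAW.law D.carrier δ (a δ) (b δ) {γ | Metric.infDist x₀ γ.curve.range ≤ r} * ENNReal.ofReal (ε₀ ^ 2) ≤ ENNReal.ofReal C * SAW.law D.carrier δ (a δ) (b δ) {γ | Metric.infDist x₀ γ.curve.range ≤ ε₀} * ENNReal.ofReal (r ^ 2) ∧ SAW.law D.carrier δ (a δ) (b δ) {γ | Metric.infDist x₀ γ.curve.range ≤ ε₀} * ENNReal.ofReal (r ^ 2) ≤ ENNReal.ofReal C * SAW.law D.carrier δ (a δ) (b δ) {γ | Metric.infDist x₀ γ.curve.range ≤ r} * ENNReal.ofReal (ε₀ ^ 2)) → (∃ (D₀ : DobrushinDomain) (a₀ b₀ : ℝ → Site 2) (x₀ : ℂ) (ρ₀ : ℝ), SAW.IsEndpointApprox D₀ a₀ b₀ ∧ 0 < ρ₀ ∧ x₀ ≠ D₀.pt 0 ∧ x₀ ≠ D₀.pt 1 ∧ D₀.carrier ∩ Metric.ball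 x₀ ρ₀ = {z : ℂ | x₀.im < z.im} ∩ Metric.ball x₀ ρ₀ ∧ IsTightAlongMesh (fun δ (γ : SAW.DomainSAW D₀.carrier δ (a₀ δ) (b₀ δ)) => γ.curve) (fun δ => SAW.law D₀.carrier δ (a₀ δ) (b₀ δ))) → SubseqIdentification := by
  intro h₁ h₂ h₃
  obtain ⟨D₀, a₀, b₀, x₀, ρ₀, hab₀, hρ₀, hx0, hx1, hwin, hT₀⟩ := h₃
  exact BoundaryAreaLaw.SubseqIdentification_of_dock_of_window h₁
    ⟨D₀, a₀, b₀, x₀, ρ₀, hab₀, hρ₀, hx0, hx1, hwin, hT₀, h₂ D₀ a₀ b₀ hab₀ x₀ ρ₀ hρ₀ hwin hx0 hx1⟩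

end Summit.CriticalPhenomena.SAWScalingLimit.Theorems.SubseqIdentification.Split
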